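import Summits.QuantumFields.BalabanUV.T4Continuum.Support.RegularTowerSubdivisionParent

/-!
# RegularTowerSubdivisionSecond — SECOND DIFFERENCES of the `R`-adic box-spline subdivision contract by EXACTLY `1∕R²`;
# the refined DERIVATIVE family stays within `(2d+1)` second-order Lipschitz units of the parent's derivative

Cell `pub-balaban`, unit `b2b-balaban-t4-ne5-p1` (row NE5 OWNER, gen 41; owner item «S2» of RULING R63).  Summits-side NEW WORK under the LEAN PLACEMENT
RULE ([folklore] lattice bookkeeping on OUR typed objects; 0 `def`; nothing printed is asserted; no citation tags).

WHY.  The padded tower of road P′ must carry, at every padded level, row NE2's bridge letter (ℓ2) `hlipD` (Lipschitz bound `βD∕L^k` of the DERIVATIVE tower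
`D_νw_ν = L^k(w_ν − w_ν∘τ_ν⁻¹)`, i.e. second differences of the connection `≤ βD∕L^{2k}`) — it feeds the derivative species' two-level consistency one
level up.  Two boxes in `subdiv = boxAvg ∘ boxAvg ∘ pullback` make the second differences EXACT averages:
`Δ_νΔ_μ (subdiv w) = R⁻² • hatAvg μ (hatAvg ν (pullback (Δ_νΔ_μ w)))` — each `boxAvg` absorbs one difference through the telescoping identity of
`RegularTowerSubdivision`, and the pullback is `R`-periodic up to the parent's shift.
WHAT ([folklore]; generic normed `ℂ`-space `E`).
 * §1 **`subdiv_tau_tau_sub`** (the identity above), **`norm_subdiv_tau_tau_sub_le`**: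
   `(∀ i, ‖(w (τ_μ (τ_ν i)) − w (τ_ν i)) − (w (τ_μ i) − w i)‖ ≤ b₂) → ‖(subdiv w (τ_μ (τ_ν x)) − subdiv w (τ_ν x)) − (subdiv w (τ_μ x) − subdiv w x)‖ ≤ b₂ ∕ R²`
   — at tower level (`R = L`, `b₂ = βD∕L^{2k}`) this is (ℓ2) at level `k + 1` with the SAME `βD`.
 * §2 THE DERIVATIVE FAMILY AGAINST ITS PARENT: `R_smul_subdiv_sub_tauInv` (`R • (subdiv w x − subdiv w (τ_ν⁻¹ x)) = hatAvg ν (boxAvg (pullback (D ∘ τ_ν))) (τ_ν⁻¹ x)`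
   with `D = w − w∘τ_ν⁻¹` the coarse backward difference) and **`norm_R_smul_bdiff_subdiv_sub_le`**:
   `0 ≤ bD → (∀ μ i, ‖D (τ_μ i) − D i‖ ≤ bD) → ‖R • (subdiv w x − subdiv w (τ_ν⁻¹ x)) − D (parT x)‖ ≤ (2d+1)·bD` — at tower level
   `‖D_νw^{(k+1)}_ν(x′) − D_νw^{(k)}_ν(parT x′)‖ ≤ (2d+1)·βD∕L^k`, the `LocalRate`-type two-level consistency of the derivative species of `regClass`.
HONEST FRAMING: rung (B)+1 bookkeeping of the FINITE-VOLUME T⁴ programme — NOT infinite volume, NOT a mass gap, NOT Clay; NE5 ∕ NE2 NOT PRINTED ∕ NOT PROVED;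
spine 0∕9; nothing of Bałaban's is asserted or instantiated.  HONEST DEPENDENCY (cell line, verbatim): continuum YM on T⁴ ⇐ BetaPertH ∧ nine spine estimates
(0/9 proved); BetaPertH ⇐ (D1) ∧ (D4) ∧ CAP+tail; G-an2-4 gates asym, D1 and NE2/3/4.  0 sorry; axioms ⊆ {propext, Classical.choice, Quot.sound}.
-/

noncomputable section

open scoped BigOperators Matrix Matrix.Norms.L2Operator

namespace Summit.QuantumFields.BalabanUV.T4Continuum.RegularTowerSubdivision

open Literature.MathematicalPhysics.QuantumFieldTheory.Balaban1983to89.B5Prop11Plancherel (fine Tor unitVec)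
open Literature.MathematicalPhysics.QuantumFieldTheory.Balaban1983to89.B5Block118 (tstep tstep_zero tstep_succ)
open Literature.MathematicalPhysics.QuantumFieldTheory.Balaban1983to89.B5G183RateTorus (cpt)
open Literature.MathematicalPhysics.QuantumFieldTheory.Balaban1983to89.B5G183RateTorusW (off)
open Summit.QuantumFields.BalabanUV.T4Continuum
open Summit.QuantumFields.BalabanUV.T4Continuum.BalabanAveragedTowerModes (par rem val_par par_cpt_add_off cpt_par_add_off_rem)
open Summit.QuantumFields.BalabanUV.T4Continuum.BlockPairingGeometry (tau parT par_add_unitVec)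
open Summit.QuantumFields.BalabanUV.T4Continuum.BalabanBlockPoincare (off_eq_sum_tstep)
open Summit.QuantumFields.BalabanUV.T4Continuum.CovariantLinePlanting (par_add_tstep)
open Summit.QuantumFields.BalabanUV.T4Continuum.AbelianCovariantLaplacian (tauInv tauInv_tau tau_tauInv)
open Summit.QuantumFields.BalabanUV.T4Continuum.NE2FromNE3BavgBridge (norm_sub_tstep_le)

variable {d : ℕ}

/-! ## §1 Second differences: the exact `1∕R²` law -/

section Second

variable (N R : ℕ) [NeZero N] [NeZero R] (M : Fin d → ℕ) [hM : ∀ μ, NeZero (M μ)]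
variable {E : Type*} [NormedAddCommGroup E] [NormedSpace ℂ E]

/-- **SECOND DIFFERENCES OF THE SUBDIVISION** (exact): `Δ_νΔ_μ (subdiv w) x = R⁻¹ • R⁻¹ • hatAvg μ (hatAvg ν (pullback (Δ_νΔ_μ w))) x`. [folklore] -/
theorem subdiv_tau_tau_sub (w : Tor (fine N M) × Fin d → E) (μ ν : Fin d) (x : Tor (fine (R * N) M) × Fin d) :
    (subdiv N R M w (tau (fine (R * N) M) μ (tau (fine (R * N) M) ν x)) - subdiv N R M w (tau (fine (R * N) M) ν x))
        - (subdiv N R M w (tau (fine (R * N) M) μ x) - subdiv N R M w x)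
      = ((R : ℂ))⁻¹ • ((R : ℂ))⁻¹ • hatAvg N R M μ (hatAvg N R M ν (pullback N R M (fun i =>
          (w (tau (fine N M) μ (tau (fine N M) ν i)) - w (tau (fine N M) ν i)) - (w (tau (fine N M) μ i) - w i)))) x := by
  have hfun : (fun z : Tor (fine (R * N) M) × Fin d =>
      pullback N R M (fun i => w (tau (fine N M) μ i) - w i) (z.1 + tstep (fine (R * N) M) ν R, z.2)
        - pullback N R M (fun i => w (tau (fine N M) μ i) - w i) z)
      = pullback N R M (fun i =>
          (w (tau (fine N M) μ (tau (fine N M) ν i)) - w (tau (fine N M) ν i)) - (w (tau (fine N M) μ i) - w i)) := by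
    funext z
    rw [pullback_add_tstep_self]
    rfl
  rw [subdiv_tau_sub, subdiv_tau_sub, ← smul_sub, hatAvg_tau, hatAvg_sub]
  congr 1
  rw [← hatAvg_smul]
  congr 1
  funext y
  rw [boxAvg_tau_sub, hfun]

/-- **THE SECOND-ORDER LETTER CONTRACTS BY EXACTLY `1∕R²`**: a uniform bound `b₂` on the coarse second differences `Δ_νΔ_μ w` gives `b₂∕R²` for
`Δ_νΔ_μ (subdiv w)`.  At tower level (`R = L`, `b₂ = βD∕L^{2k}`): row NE2's bridge letter (ℓ2) `hlipD` at level `k + 1` with the SAME `βD`. [folklore] -/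
theorem norm_subdiv_tau_tau_sub_le {w : Tor (fine N M) × Fin d → E} {μ ν : Fin d} {b₂ : ℝ}
    (hw : ∀ i, ‖(w (tau (fine N M) μ (tau (fine N M) ν i)) - w (tau (fine N M) ν i)) - (w (tau (fine N M) μ i) - w i)‖ ≤ b₂)
    (x : Tor (fine (R * N) M) × Fin d) :
    ‖(subdiv N R M w (tau (fine (R * N) M) μ (tau (fine (R * N) M) ν x)) - subdiv N R M w (tau (fine (R * N) M) ν x))
        - (subdiv N R M w (tau (fine (R * N) M) μ x) - subdiv N R M w x)‖ ≤ b₂ / (R : ℝ) ^ 2 := by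
  have hR : (0 : ℝ) < R := by exact_mod_cast Nat.pos_of_ne_zero (NeZero.ne R)
  rw [subdiv_tau_tau_sub, norm_smul, norm_smul, norm_inv, Complex.norm_natCast, ← mul_assoc, ← mul_inv, ← sq, div_eq_inv_mul]
  refine mul_le_mul_of_nonneg_left ?_ (by positivity)
  exact norm_hatAvg_le μ (fun y => norm_hatAvg_le ν (fun z => norm_pullback_le hw z) y) x

end Second

/-! ## §2 The refined derivative family against its parent -/

section Derivative

variable (N R : ℕ) [NeZero N] [NeZero R] (M : Fin d → ℕ) [hM : ∀ μ, NeZero (M μ)]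
variable {E : Type*} [NormedAddCommGroup E] [NormedSpace ℂ E]

/-- `R • (subdiv w x − subdiv w (τ_ν⁻¹ x))` is the hat-box average of the pullback of the coarse FORWARD difference, based at `τ_ν⁻¹ x`. [folklore] -/
theorem R_smul_subdiv_sub_tauInv (w : Tor (fine N M) × Fin d → E) (ν : Fin d) (x : Tor (fine (R * N) M) × Fin d) :
    (R : ℂ) • (subdiv N R M w x - subdiv N R M w (tauInv (fine (R * N) M) ν x))
      = hatAvg N R M ν (boxAvg N R M (pullback N R M (fun i => w (tau (fine N M) ν i) - w i))) (tauInv (fine (R * N) M) ν x) := by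
  have hR : (R : ℂ) ≠ 0 := by exact_mod_cast NeZero.ne R
  have hx : x = tau (fine (R * N) M) ν (tauInv (fine (R * N) M) ν x) := (tau_tauInv _ ν x).symm
  calc (R : ℂ) • (subdiv N R M w x - subdiv N R M w (tauInv (fine (R * N) M) ν x))
      = (R : ℂ) • (subdiv N R M w (tau (fine (R * N) M) ν (tauInv (fine (R * N) M) ν x))
          - subdiv N R M w (tauInv (fine (R * N) M) ν x)) := by rw [← hx]
    _ = _ := by rw [subdiv_tau_sub, smul_smul, mul_inv_cancel₀ hR, one_smul]

omit [NeZero R] [NormedSpace ℂ E] in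
/-- the path lemma with a prescribed budget: `Σ_ν c_ν ≤ m ⟹ ‖w (p + Σ_ν c_ν e_ν, a) − w (p, a)‖ ≤ m·lip`. [folklore] -/
theorem norm_sub_le_of_path {w : Tor (fine N M) × Fin d → E} {lip : ℝ} (hlip0 : 0 ≤ lip)
    (hlip : ∀ ν i, ‖w (tau (fine N M) ν i) - w i‖ ≤ lip) (p : Tor (fine N M)) (a : Fin d) (c : Fin d → ℕ) {m : ℝ}
    (hc : ∑ ν, (c ν : ℝ) ≤ m) : ‖w (p + ∑ ν, tstep (fine N M) ν (c ν), a) - w (p, a)‖ ≤ m * lip :=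
  (norm_sub_sum_tstep_le' w hlip p a c Finset.univ).trans (mul_le_mul_of_nonneg_right hc hlip0)

omit [NeZero N] [NeZero R] hM in
/-- a unit vector is one own-direction step, written as a sum over directions. [folklore] -/
theorem unitVec_eq_sum_tstep_ite {Nf : Fin d → ℕ} (ν : Fin d) :
    unitVec Nf ν = ∑ μ, tstep Nf μ (if μ = ν then 1 else 0) := by
  rw [Finset.sum_eq_single ν]
  · rw [if_pos rfl, tstep_succ, tstep_zero, zero_add]
  · intro μ _ hμ; rw [if_neg hμ, tstep_zero]
  · intro h; exact absurd (Finset.mem_univ ν) h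

/-- **THE REFINED DERIVATIVE FAMILY AGAINST ITS PARENT**: with `D i = w i − w (τ_ν⁻¹ i)` the coarse backward difference in direction `ν`,
`0 ≤ bD → (∀ μ i, ‖D (τ_μ i) − D i‖ ≤ bD) → ‖R • (subdiv w x − subdiv w (τ_ν⁻¹ x)) − D (parT x)‖ ≤ (2d+1)·bD`: every value averaged into the
refined backward difference is `D` at a coarse site at most `2d + 1` unit steps from `parT x`.  At tower level (`R = L`, `w = w^{(k)}_ν`, `bD = βD∕L^{2k}`,
multiplied by `L^k`): `‖D_νw^{(k+1)}_ν(x′) − D_νw^{(k)}_ν(parT x′)‖ ≤ (2d+1)·βD∕L^k`. [folklore] -/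
theorem norm_R_smul_bdiff_subdiv_sub_le {w : Tor (fine N M) × Fin d → E} {ν : Fin d} {bD : ℝ} (hbD : 0 ≤ bD)
    (hD : ∀ μ i, ‖(w (tau (fine N M) μ i) - w (tauInv (fine N M) ν (tau (fine N M) μ i))) - (w i - w (tauInv (fine N M) ν i))‖ ≤ bD)
    (x : Tor (fine (R * N) M) × Fin d) :
    ‖(R : ℂ) • (subdiv N R M w x - subdiv N R M w (tauInv (fine (R * N) M) ν x))
        - (w (parT N R M x) - w (tauInv (fine N M) ν (parT N R M x)))‖ ≤ (2 * d + 1) * bD := by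
  -- the coarse backward difference and its Lipschitz bound in the `tau` form
  set D : Tor (fine N M) × Fin d → E := fun i => w i - w (tauInv (fine N M) ν i) with hDdef
  have hDlip : ∀ μ i, ‖D (tau (fine N M) μ i) - D i‖ ≤ bD := fun μ i => hD μ i
  -- the forward difference is `D ∘ τ_ν`
  have hfwd : (fun i => w (tau (fine N M) ν i) - w i) = fun i => D (tau (fine N M) ν i) := by
    funext i; simp only [hDdef, tauInv_tau]
  -- base point `y = τ_ν⁻¹ x`, so `x = τ_ν y`
  set y := tauInv (fine (R * N) M) ν x with hy
  have hx : x = tau (fine (R * N) M) ν y := (tau_tauInv (fine (R * N) M) ν x).symm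
  rw [R_smul_subdiv_sub_tauInv, hfwd, ← hy]
  -- the target value as a constant average
  have hconst : w (parT N R M x) - w (tauInv (fine N M) ν (parT N R M x)) = D (parT N R M x) := rfl
  rw [hconst]
  have e : hatAvg N R M ν (boxAvg N R M (pullback N R M (fun i => D (tau (fine N M) ν i)))) y - D (parT N R M x)
      = hatAvg N R M ν (fun z => boxAvg N R M (fun z' => pullback N R M (fun i => D (tau (fine N M) ν i)) z' - D (parT N R M x)) z) y := by
    have h1 : ∀ z, boxAvg N R M (fun z' => pullback N R M (fun i => D (tau (fine N M) ν i)) z' - D (parT N R M x)) z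
        = boxAvg N R M (pullback N R M (fun i => D (tau (fine N M) ν i))) z - D (parT N R M x) := fun z => by
      have h := boxAvg_sub (pullback N R M (fun i => D (tau (fine N M) ν i))) (fun _ => D (parT N R M x)) z
      rw [boxAvg_const] at h
      exact h.symm
    have h2 := hatAvg_sub ν (boxAvg N R M (pullback N R M (fun i => D (tau (fine N M) ν i)))) (fun _ => D (parT N R M x)) y
    rw [hatAvg_const] at h2
    rw [h2]
    congr 1
    funext z
    exact (h1 z).symm
  rw [e]
  refine norm_invRd_smul_sum_le fun j => norm_invRd_smul_sum_le fun j' => ?_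
  -- one term: `D` at `τ_ν (parT (y.1 + off j₀ + off j′, c))` against `D (parT x)`, `x = τ_ν y`
  show ‖D (tau (fine N M) ν (parT N R M (y.1 + off N R M (Function.update j ν 0) + off N R M j', y.2))) - D (parT N R M x)‖ ≤ _
  -- the two parents as paths from `par y.1`
  have hsrc : par N R M (y.1 + off N R M (Function.update j ν 0) + off N R M j')
      = par N R M y.1 + ∑ μ, tstep (fine N M) μ ((if R ≤ (y.1 μ).val % R + ((Function.update j ν 0) μ : ℕ) then 1 else 0)
          + (if R ≤ ((y.1 + off N R M (Function.update j ν 0)) μ).val % R + (j' μ : ℕ) then 1 else 0)) := by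
    rw [par_add_off, par_add_off, add_assoc, ← Finset.sum_add_distrib]
    congr 1
    refine Finset.sum_congr rfl fun μ _ => ?_
    rw [tstep_add']
  -- abbreviate the carry counts
  set c : Fin d → ℕ := fun μ => (if R ≤ (y.1 μ).val % R + ((Function.update j ν 0) μ : ℕ) then 1 else 0)
      + (if R ≤ ((y.1 + off N R M (Function.update j ν 0)) μ).val % R + (j' μ : ℕ) then 1 else 0) with hc
  have hc2 : ∀ μ, c μ ≤ 2 := fun μ => by simp only [hc]; split_ifs <;> omega
  have hsrc' : tau (fine N M) ν (parT N R M (y.1 + off N R M (Function.update j ν 0) + off N R M j', y.2))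
      = (par N R M y.1 + unitVec (fine N M) ν + ∑ μ, tstep (fine N M) μ (c μ), y.2) := by
    show (par N R M (y.1 + off N R M (Function.update j ν 0) + off N R M j') + unitVec (fine N M) ν, y.2) = _
    rw [hsrc, add_right_comm]
  rw [hsrc']
  -- the target parent: `par (y.1 + e_ν)` is `par y.1 + e_ν` or `par y.1`
  have hx1 : (parT N R M x) = (par N R M (y.1 + unitVec (fine (R * N) M) ν), y.2) := by rw [hx]; rfl
  rw [hx1, par_add_unitVec]
  split_ifs with hface
  · -- the face is crossed: both points hang off `par y.1 + e_ν`
    have hcs : ∑ μ : Fin d, (c μ : ℝ) ≤ 2 * d := by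
      calc ∑ μ : Fin d, (c μ : ℝ) ≤ ∑ _μ : Fin d, (2 : ℝ) := Finset.sum_le_sum fun μ _ => by exact_mod_cast hc2 μ
        _ = 2 * d := by rw [Finset.sum_const, Finset.card_univ, Fintype.card_fin, nsmul_eq_mul, mul_comm]
    exact (norm_sub_le_of_path N M hbD hDlip (par N R M y.1 + unitVec (fine N M) ν) y.2 c hcs).trans
      (mul_le_mul_of_nonneg_right (by linarith) hbD)
  · -- no face crossed: the extra `e_ν` joins the path
    have epath : par N R M y.1 + unitVec (fine N M) ν + ∑ μ, tstep (fine N M) μ (c μ)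
        = par N R M y.1 + ∑ μ, tstep (fine N M) μ (c μ + if μ = ν then 1 else 0) := by
      rw [unitVec_eq_sum_tstep_ite, add_assoc, ← Finset.sum_add_distrib]
      congr 1
      refine Finset.sum_congr rfl fun μ _ => ?_
      rw [← tstep_add', add_comm]
    rw [epath]
    refine norm_sub_le_of_path N M hbD hDlip (par N R M y.1) y.2 _ ?_
    have hsplit : ∑ μ : Fin d, ((c μ + if μ = ν then 1 else 0 : ℕ) : ℝ)
        = ∑ μ : Fin d, (c μ : ℝ) + ∑ μ : Fin d, ((if μ = ν then 1 else 0 : ℕ) : ℝ) := by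
      rw [← Finset.sum_add_distrib]
      refine Finset.sum_congr rfl fun μ _ => ?_
      push_cast; ring
    have hone : ∑ μ : Fin d, ((if μ = ν then 1 else 0 : ℕ) : ℝ) = 1 := by
      rw [Finset.sum_eq_single ν]
      · simp
      · intro μ _ hμ; simp [hμ]
      · intro h; exact absurd (Finset.mem_univ ν) h
    rw [hsplit, hone]
    have : ∑ μ : Fin d, (c μ : ℝ) ≤ 2 * d := by
      calc ∑ μ : Fin d, (c μ : ℝ) ≤ ∑ _μ : Fin d, (2 : ℝ) := Finset.sum_le_sum fun μ _ => by exact_mod_cast hc2 μ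
        _ = 2 * d := by rw [Finset.sum_const, Finset.card_univ, Fintype.card_fin, nsmul_eq_mul, mul_comm]
    linarith

end Derivative

end Summit.QuantumFields.BalabanUV.T4Continuum.RegularTowerSubdivision

end
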